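import Summits.QuantumFields.BalabanUV.T4Continuum.Support.NE3SlicePoincareCoarseData
import Summits.QuantumFields.BalabanUV.T4Continuum.Support.NE3CompetitorSlice
import Summits.QuantumFields.BalabanUV.T4Continuum.Support.NE3CornerGaugePoincare
import Summits.QuantumFields.BalabanUV.T4Continuum.Support.NE3TowerBondVsSegment
import HarnessLib

/-!
# NE3SlicePoincareCompetitorEnergy (T⁴ programme, node NE3, row K6, cut ρ-g23-3 §3 part K6c-1b-β, file 1∕2) — THE UNFIXED S7 COMPETITOR
# `F₀ := competitorW M W (bmeanIterW ζ′) (ζ′∘corners)` AT `U := cavgIter`: ITS ENERGY WITH THE COARSE DATA INSERTED, AND THE J2-SMALLNESS OF THE NESTED-FIX DATA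
Leaf seat `b2b-balaban-t4-ne3-formalise-leaf-02` (gen 6), row K6 (blueprint `HOME/t4/b2b-balaban-t4-ne3-p1/g23/D-ne3p1-g23-1.md` (S7); junction J-ne3leaf02g6-1 ∕ ρ-g23-5;
disprover D-ne3r2-g9-3 (3)(4): `a_U := radIter d L (k+1) x`, `δ := J4`, `b := bmeanIterW ζ′`).  BY NAME: K5c f5 `NE3CovariantCompetitor.sum_normSq_gaugeDir_competitorW_le`,
K6c-1b-α `NE3SlicePoincareCoarseData`, J2 `NE3NestedBlockMeanBridge`, J4 `NE3TowerBondVsSegment.norm_cavgIter_sub_bseg_le_top`, K6-Ξ's `sum_nhsNormSq_le_two_blocks`.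
WHAT ([folklore]; 0 sorry; 0 def; `M = L^{k+1}`, letters over `periodBox (M·N)`: `h² = ΣΣ nhsNormSq η′`, `Z = Σ nhsNormSq ζ′`, `G_ζ = ΣΣ nhsNormSq (gaugeDir W ζ′)`,
`ℰ′` = K6b-3's bound, `C_J = 4d²(M−1)²x + 16d·loopRad(r_k)`, `κ = 1∕M + 2(d−1)(M−1)x`, `K₁ = 8(dMx)² + (16∕M²)(J4 + 9d²M²x)²`, `K₂ = 2^{2d+4}d²(d−1)²a_U² + 8(9d²M²x + d·J4)²`):
§1 `norm_add_sq_le'`, `bmeanIterW_sub'`, `bmeanW_sub'`; §2 **`sum_normSq_gaugeDir_F0_le`**: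
`Σ‖gaugeDir W F₀‖² ≤ B₅ := 3(2^{d+1}M⁻²(card n·D_c) + d2^dK₁(card n·Z)) + 12d(48(dL)(card n·h²)) + 3dκ²(2·64^d(2^{3d+2}d(card n·D_c) + 2^dK₂(card n·Z)) + 2·64^d(48(dL)(card n·h²)))`,
`D_c = 2M²h² + 2ℰ′`; §3 **`sum_nhsNormSq_F0_sub_le`** (`Σ nhsNormSq (F₀ − ζ′) ≤ 8M²Σ‖gaugeDir W F₀‖² + 8M²G_ζ + 4·card n·C_J²·Z`, under K6-Ξ's displayed smallness) and
**`pow_mul_sum_normSq_target_sub_le`** (`M^d·Σ_z‖bmeanIterW ζ′ z − bmeanIterW F₀ z‖² ≤ 2C_J²(card n·Σ nhsNormSq (F₀ − ζ′)) + 2C_J²(card n·Z)`).  File 2∕2 `NE3SlicePoincareCompetitorEnd` concludes.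
HONEST FRAMING.  Kinematics + bookkeeping of OUR competitor at ONE unitary background in the tower's small-field class; nothing about Bałaban's minimisers; (P♮)_W, (ML_w) at `W ≠ 1`,
T-E_w and NE3 are NOT proved; spine PROVED 0∕9; finite T⁴ rung (B)+1 — NOT infinite volume, NOT mass gap, NOT BetaPertH, NOT Clay.  ABSOLUTE RULE kept: no printed sentence is a hypothesis.
PLACEMENT: `Summits/QuantumFields/BalabanUV/`.  HONEST DEPENDENCY: continuum YM on T⁴ ⇐ BetaPertH ∧ nine spine estimates (0/9 proved); BetaPertH ⇐ (D1) ∧ (D4) ∧ CAP+tail; G-an2-4 gates asym, D1 and NE2/3/4.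
-/

set_option autoImplicit false

open scoped BigOperators Matrix.Norms.L2Operator
open Finset

namespace Summit.QuantumFields.BalabanUV.T4Continuum.NE3SlicePoincareCompetitorEnergy

open Literature.MathematicalPhysics.QuantumFieldTheory.Balaban1983to89
open B7Prop1Explicit B7Prop2Explicit MatrixNorms
open T4AveragingDeficitWall (IsUnitaryCfg IsSkewDir SmallField Ad)
open T4AveragingDeficitWallBoundary (IsPeriodicCfg periodBox)
open AveragingDeficitPeriodicCounting (IsPeriodicDir)
open AveragingDeficitTwoLevelPrep (prop1Radius)
open AveragingDeficitMultiLevelPrep (cavgIter tower LevelSmall radIter cavgIter_unitary_small isPeriodicCfg_cavgIter)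
open AveragingDeficitBlockDensity (bseg)
open SpreadLift (loopRad)
open BlockAveragePushDirGauge (gaugeDir)
open NE3CovariantCalculus (nhsNormSq_sub_le)
open NE3CovariantBlockMean (bmeanW bmeanIterW bmeanIterW_skew_periodic)
open NE3FrameFreeSliceW (frameFreeBlockLandauW cornerGaugeSpaceW mem_cornerGaugeSpaceW_iff bmeanW_add bmeanIterW_add)
open NE3CurvedCornerGaugeSpace (cornerGaugeSpace₀)
open NE3CovariantLineSumsL2Tower (rho S2sum)
open NE3ExactLineSumsTower (DSum)
open NE3NestedMeanBlockOperator (tentMean tentMean_pos inv_le_tentMean)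
open NE3NestedBlockMeanBridge (sum_norm_bmeanIterW_sub_bmeanW_sq_le sum_nhsNormSq_bmeanIterW_sub_bmeanW_le)
open NE3CornerGaugePoincare (sum_nhsNormSq_le_two_blocks)
open NE3CovariantCompetitor (competitorW competitorW_corner bmeanW_competitorW competitorW_mem_skewAdjoint competitorW_add_period
  sum_normSq_gaugeDir_competitorW_le)
open NE3CompetitorSlice (nfixCompetitorW nfixCompetitorW_sub_mem_cornerGaugeSpaceW sum_normSq_gaugeDir_nfixCompetitorW_le)
open NE3TowerBondVsSegment (norm_cavgIter_sub_bseg_le_top)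
open NE3SlicePoincareSkeleton (gaugeDir_sub_fun')
open NE3SlicePoincareRemainderE (sum_norm_sq_le_card_mul sum_sum_norm_sq_le_card_mul)
open NE3SlicePoincareCoarseData (pow_mul_sum_normSq_gaugeDir_bmeanIterW_le pow_mul_sum_normSq_bmeanIterW_le sum_normSq_corner_sub_bmeanIterW_le)

noncomputable section

variable {d : ℕ} {n : Type*} [Fintype n] [DecidableEq n]

/-! ## §1 Bookkeeping -/

/-- `‖A + B‖² ≤ 2‖A‖² + 2‖B‖²`. [folklore] -/
theorem norm_add_sq_le' (A B : Matrix n n ℂ) : ‖A + B‖ ^ 2 ≤ 2 * ‖A‖ ^ 2 + 2 * ‖B‖ ^ 2 := by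
  have h := norm_add_le A B
  nlinarith [sq_nonneg (‖A‖ - ‖B‖), norm_nonneg (A + B), norm_nonneg A, norm_nonneg B]

/-- `bmeanIterW` of a pointwise difference. [folklore] -/
theorem bmeanIterW_sub' (L j : ℕ) (W : Site d → Fin d → (Matrix n n ℂ)ˣ) (A B : Site d → Matrix n n ℂ) (z : Site d) :
    bmeanIterW L j W (fun y => A y - B y) z = bmeanIterW L j W A z - bmeanIterW L j W B z := by
  have hfun : (fun y => A y - B y) + B = A := by funext y; simp
  have h := bmeanIterW_add L j W (fun y => A y - B y) B
  rw [hfun] at h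
  have hz := congr_fun h z
  simp only [Pi.add_apply] at hz
  rw [hz]; abel

/-- `bmeanW` of a pointwise difference. [folklore] -/
theorem bmeanW_sub' (M : ℕ) (W : Site d → Fin d → (Matrix n n ℂ)ˣ) (A B : Site d → Matrix n n ℂ) (z : Site d) :
    bmeanW M W (fun y => A y - B y) z = bmeanW M W A z - bmeanW M W B z := by
  have hfun : (fun y => A y - B y) + B = A := by funext y; simp
  have h := bmeanW_add M W (fun y => A y - B y) B
  rw [hfun] at h
  have hz := congr_fun h z
  simp only [Pi.add_apply] at hz
  rw [hz]; abel

/-! ## §2 The energy of `F₀ := competitorW M W ψ c` with the coarse data inserted -/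

/-- **THE ENERGY OF THE UNFIXED COMPETITOR `F₀`** (f5 `sum_normSq_gaugeDir_competitorW_le` at `b := ψ`, `c := ζ′∘corners`, `U := cavgIter`,
`a := x`, `a_U := radIter d L (k+1) x`, `δ := J4`; then K6c-1b-α for `D`, `S_b`, `S_h`): `Σ‖gaugeDir W F₀‖² ≤ B₅` (module docstring; `3 ≤ d`). [folklore] -/
theorem sum_normSq_gaugeDir_F0_le [Nonempty n] (hd : 3 ≤ d) {L N : ℕ} (hL : 2 ≤ L) (hN : 1 ≤ N) (k : ℕ)
    {W : Site d → Fin d → (Matrix n n ℂ)ˣ} {x : ℝ} (hWu : IsUnitaryCfg W) (hWP : IsPeriodicCfg W ((tower L N (k + 1) : ℕ) : ℤ))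
    (hx : 0 ≤ x) (hs : LevelSmall d L k x) (hWx : SmallField W x) (hS2 : S2sum d L (k + 1) x ≤ rho d L / 2)
    {Y : Site d → Fin d → Matrix n n ℂ} (hY : Y ∈ frameFreeBlockLandauW (d := d) (n := n) L N (k + 1) W)
    {η' : Site d → Fin d → Matrix n n ℂ} (hη'P : IsPeriodicDir η' ((tower L N (k + 1) : ℕ) : ℤ)) {ζ' : Site d → Matrix n n ℂ}
    (hζ'P : ∀ (y : Site d) (τ : Fin d), ζ' (y + ((tower L N (k + 1) : ℕ) : ℤ) • e τ) = ζ' y)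
    (hζ's : ∀ y : Site d, ζ' y ∈ skewAdjoint (Matrix n n ℂ))
    (hYeq : ∀ (y : Site d) (κ : Fin d), Y y κ = η' y κ + gaugeDir W ζ' y κ) :
    ∑ y ∈ periodBox (d := d) (L ^ (k + 1) * N), ∑ α : Fin d,
        ‖gaugeDir W (competitorW (L ^ (k + 1)) W (bmeanIterW L (k + 1) W ζ') (fun z => ζ' ((((L ^ (k + 1) : ℕ) : ℤ)) • z))) y α‖ ^ 2
      ≤ 3 * ((2 : ℝ) ^ (d + 1) * (((L : ℝ) ^ (k + 1)) ^ 2)⁻¹ * ((Fintype.card n : ℝ) * (2 * ((L : ℝ) ^ (k + 1)) ^ 2 * ∑ y ∈ periodBox (d := d) (L ^ (k + 1) * N), ∑ κ : Fin d, nhsNormSq (η' y κ) + 2 * (4 * (2 * ((4 * d + 5) / 10 * DSum d L (k + 1) x)) ^ 2 * ((L : ℝ) ^ (k + 1)) ^ 2 * ((Fintype.card n : ℝ) * ∑ y ∈ periodBox (d := d) (L ^ (k + 1) * N), ∑ κ : Fin d, nhsNormSq (η' y κ)) + 16 * S2sum d L (k + 1) x ^ 2 * ((L : ℝ) ^ d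 * ((L : ℝ) ^ k) ^ 2) * ((Fintype.card n : ℝ) * ∑ y ∈ periodBox (d := d) (L ^ (k + 1) * N), ∑ κ : Fin d, nhsNormSq (Y y κ)) + 2 * ((d : ℝ) * (20 * loopRad d L ((prop1Radius d L)^[k] x)) ^ 2) * ((Fintype.card n : ℝ) * ∑ y ∈ periodBox (d := d) (L ^ (k + 1) * N), nhsNormSq (ζ' y))))) + (d : ℝ) * (2 : ℝ) ^ d * (8 * ((d : ℝ) * ((L : ℝ) ^ (k + 1)) * x) ^ 2 + (16 / ((L : ℝ) ^ (k + 1)) ^ 2) * (8 * loopRad d L ((prop1Radius d L)^[k] x) + 9 * (d : ℝ) ^ 2 * ((L : ℝ) ^ (k + 1)) ^ 2 * x) ^ 2) * ((Fintype.card n : ℝ) * ∑ y ∈ periodBox (d := d) (L ^ (k + 1) * N), nhsNormSq (ζ' y)))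
        + 12 * (d : ℝ) * (48 * ((d : ℝ) * L) * ((Fintype.card n : ℝ) * ∑ y ∈ periodBox (d := d) (L ^ (k + 1) * N), ∑ κ : Fin d, nhsNormSq (η' y κ)))
        + 3 * ((d : ℝ) * (1 / ((L : ℝ) ^ (k + 1)) + 2 * (((d : ℝ) - 1) * (((L : ℝ) ^ (k + 1)) - 1) * x)) ^ 2)
          * (2 * (64 : ℝ) ^ d * ((2 : ℝ) ^ (3 * d + 2) * d * ((Fintype.card n : ℝ) * (2 * ((L : ℝ) ^ (k + 1)) ^ 2 * ∑ y ∈ periodBox (d := d) (L ^ (k + 1) * N), ∑ κ : Fin d, nhsNormSq (η' y κ) + 2 * (4 * (2 * ((4 * d + 5) / 10 * DSum d L (k + 1) x)) ^ 2 * ((L : ℝ) ^ (k + 1)) ^ 2 * ((Fintype.card n : ℝ) * ∑ y ∈ periodBox (d := d) (L ^ (k + 1) * N), ∑ κ : Fin d, nhsNormSq (η' y κ)) + 16 * S2sum d L (k + 1) x ^ 2 * ((L : ℝ) ^ d * ((L : ℝ) ^ k) ^ 2) * ((Fintype.card n : ℝ) * ∑ y ∈ periodBox (d := d) (L ^ (k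 + 1) * N), ∑ κ : Fin d, nhsNormSq (Y y κ)) + 2 * ((d : ℝ) * (20 * loopRad d L ((prop1Radius d L)^[k] x)) ^ 2) * ((Fintype.card n : ℝ) * ∑ y ∈ periodBox (d := d) (L ^ (k + 1) * N), nhsNormSq (ζ' y))))) + (2 : ℝ) ^ d * ((2 : ℝ) ^ (2 * d + 4) * (d : ℝ) ^ 2 * ((d : ℝ) - 1) ^ 2 * (radIter d L (k + 1) x) ^ 2 + 8 * (9 * (d : ℝ) ^ 2 * ((L : ℝ) ^ (k + 1)) ^ 2 * x + (d : ℝ) * (8 * loopRad d L ((prop1Radius d L)^[k] x))) ^ 2) * ((Fintype.card n : ℝ) * ∑ y ∈ periodBox (d := d) (L ^ (k + 1) * N), nhsNormSq (ζ' y)))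
            + 2 * (64 : ℝ) ^ d * (48 * ((d : ℝ) * L) * ((Fintype.card n : ℝ) * ∑ y ∈ periodBox (d := d) (L ^ (k + 1) * N), ∑ κ : Fin d, nhsNormSq (η' y κ)))) := by
  haveI : NeZero N := ⟨by omega⟩
  have hd0 : 0 < d := by omega
  have hL1 : 1 ≤ L := le_trans (by norm_num) hL
  have hM1 : 1 ≤ L ^ (k + 1) := Nat.one_le_pow _ _ (by omega)
  have hM2 : 2 ≤ L ^ (k + 1) := le_trans hL (Nat.le_self_pow (Nat.succ_ne_zero k) L)
  have htow : tower L N (k + 1) = L ^ (k + 1) * N := NE3CurvedProjectedLandau.tower_eq_pow_mul L N (k + 1)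
  have hMR : (((L ^ (k + 1) : ℕ) : ℝ)) = (L : ℝ) ^ (k + 1) := by push_cast; ring
  have hM0 : (0 : ℝ) < (L : ℝ) ^ (k + 1) := by
    have : (0 : ℝ) < L := by exact_mod_cast (by omega : 0 < L)
    positivity
  obtain ⟨hUu, haU, hUa⟩ := cavgIter_unitary_small (d := d) hL1 k hWu hx hs hWx
  have hUP : IsPeriodicCfg (cavgIter L (k + 1) W) (N : ℤ) := isPeriodicCfg_cavgIter L N (k + 1) hWP
  obtain ⟨hψs, hψP⟩ := bmeanIterW_skew_periodic (M := N) hL1 k hWu hWP hx hs hWx hζ's hζ'P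
  have htz : (((L ^ (k + 1) : ℕ) : ℤ)) * (N : ℤ) = ((tower L N (k + 1) : ℕ) : ℤ) := by rw [htow]; push_cast; ring
  have hcP : ∀ (z : Site d) (τ : Fin d), (fun z => ζ' ((((L ^ (k + 1) : ℕ) : ℤ)) • z)) (z + (N : ℤ) • e τ)
      = (fun z => ζ' ((((L ^ (k + 1) : ℕ) : ℤ)) • z)) z := by
    intro z τ
    simp only [smul_add, smul_smul, htz, hζ'P]
  have hcs : ∀ z : Site d, (fun z => ζ' ((((L ^ (k + 1) : ℕ) : ℤ)) • z)) z ∈ skewAdjoint (Matrix n n ℂ) := fun z => hζ's _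
  have hδ : ∀ (w : Site d) (α : Fin d), ‖((cavgIter L (k + 1) W w α : (Matrix n n ℂ)ˣ) : Matrix n n ℂ)
      - ((bseg (L ^ (k + 1)) W w α : (Matrix n n ℂ)ˣ) : Matrix n n ℂ)‖ ≤ 8 * loopRad d L ((prop1Radius d L)^[k] x) :=
    fun w α => norm_cavgIter_sub_bseg_le_top hL k hWu hx hs hWx w α
  -- f5
  have h5 := sum_normSq_gaugeDir_competitorW_le (M := L ^ (k + 1)) (N := N) hM2 hN hd0 hWu hUu hx haU hWx hUa hδ hUP
    (b := bmeanIterW L (k + 1) W ζ') (c := fun z => ζ' ((((L ^ (k + 1) : ℕ) : ℤ)) • z)) hψP hcP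
  rw [hMR] at h5
  -- the coarse data
  have hD := pow_mul_sum_normSq_gaugeDir_bmeanIterW_le hL hN k hWu hWP hx hs hWx hS2 hY hη'P hζ'P hYeq
  have hSb := pow_mul_sum_normSq_bmeanIterW_le hL1 k hWu hx hs hWx ζ' N
  have hSh := sum_normSq_corner_sub_bmeanIterW_le hd hL hN k hWu hWP hx hs hWx hS2 hY hη'P hζ'P hζ's hYeq
  -- abbreviations
  set M : ℝ := (L : ℝ) ^ (k + 1) with hMdef
  set D := ∑ z ∈ periodBox (d := d) N, ∑ α : Fin d,
    ‖gaugeDir (cavgIter L (k + 1) W) (bmeanIterW L (k + 1) W ζ') z α‖ ^ 2 with hDdef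
  set Sb := ∑ z ∈ periodBox (d := d) N, ‖bmeanIterW L (k + 1) W ζ' z‖ ^ 2 with hSbdef
  set Sh := ∑ z ∈ periodBox (d := d) N, ‖ζ' ((((L ^ (k + 1) : ℕ) : ℤ)) • z) - bmeanIterW L (k + 1) W ζ' z‖ ^ 2 with hShdef
  set Dc := (Fintype.card n : ℝ) * (2 * M ^ 2 * ∑ y ∈ periodBox (d := d) (L ^ (k + 1) * N), ∑ κ : Fin d, nhsNormSq (η' y κ)
      + 2 * (4 * (2 * ((4 * d + 5) / 10 * DSum d L (k + 1) x)) ^ 2 * M ^ 2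
            * ((Fintype.card n : ℝ) * ∑ y ∈ periodBox (d := d) (L ^ (k + 1) * N), ∑ κ : Fin d, nhsNormSq (η' y κ))
          + 16 * S2sum d L (k + 1) x ^ 2 * ((L : ℝ) ^ d * ((L : ℝ) ^ k) ^ 2)
            * ((Fintype.card n : ℝ) * ∑ y ∈ periodBox (d := d) (L ^ (k + 1) * N), ∑ κ : Fin d, nhsNormSq (Y y κ))
          + 2 * ((d : ℝ) * (20 * loopRad d L ((prop1Radius d L)^[k] x)) ^ 2)
            * ((Fintype.card n : ℝ) * ∑ y ∈ periodBox (d := d) (L ^ (k + 1) * N), nhsNormSq (ζ' y)))) with hDc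
  set Zc := (Fintype.card n : ℝ) * ∑ y ∈ periodBox (d := d) (L ^ (k + 1) * N), nhsNormSq (ζ' y) with hZc
  set Hc := 48 * ((d : ℝ) * L) * ((Fintype.card n : ℝ) * ∑ y ∈ periodBox (d := d) (L ^ (k + 1) * N), ∑ κ : Fin d, nhsNormSq (η' y κ)) with hHc
  set κ2 := (1 / M + 2 * (((d : ℝ) - 1) * (M - 1) * x)) ^ 2 with hκ2
  set K1 := 8 * ((d : ℝ) * M * x) ^ 2 + (16 / M ^ 2) * (8 * loopRad d L ((prop1Radius d L)^[k] x) + 9 * (d : ℝ) ^ 2 * M ^ 2 * x) ^ 2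
    with hK1
  set K2 := (2 : ℝ) ^ (2 * d + 4) * (d : ℝ) ^ 2 * ((d : ℝ) - 1) ^ 2 * (radIter d L (k + 1) x) ^ 2
    + 8 * (9 * (d : ℝ) ^ 2 * M ^ 2 * x + (d : ℝ) * (8 * loopRad d L ((prop1Radius d L)^[k] x))) ^ 2 with hK2
  -- the positive weights
  have hMd : (0 : ℝ) < M ^ d := by positivity
  have hκ0 : 0 ≤ κ2 := by positivity
  have hK10 : 0 ≤ K1 := by positivity
  have hK20 : 0 ≤ K2 := by positivity
  have hSh0 : 0 ≤ Sh := sum_nonneg fun z _ => by positivity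
  -- rewrite f5's right-hand side in terms of `M^d·D`, `M^d·S_b`, `S_h`
  have hid1 : (2 : ℝ) ^ (d + 1) * (M ^ d / M ^ 2) * D = (2 : ℝ) ^ (d + 1) * (M ^ 2)⁻¹ * (M ^ d * D) := by ring
  have hid2 : (d : ℝ) * (2 : ℝ) ^ d * M ^ d * K1 * Sb = (d : ℝ) * (2 : ℝ) ^ d * K1 * (M ^ d * Sb) := by ring
  have hid3 : 3 * ((d : ℝ) * M ^ d * κ2) * (2 * (64 : ℝ) ^ d * ((2 : ℝ) ^ (3 * d + 2) * d * D + (2 : ℝ) ^ d * K2 * Sb)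
        + 2 * (64 : ℝ) ^ d * ((M ^ d)⁻¹) ^ 2 * Sh)
      = 3 * ((d : ℝ) * κ2) * (2 * (64 : ℝ) ^ d * ((2 : ℝ) ^ (3 * d + 2) * d * (M ^ d * D) + (2 : ℝ) ^ d * K2 * (M ^ d * Sb))
        + 2 * (64 : ℝ) ^ d * ((M ^ d)⁻¹ * Sh)) := by
    field_simp
  -- `(M^d)⁻¹·S_h ≤ S_h ≤ Hc`
  have hMd1 : (M ^ d)⁻¹ ≤ 1 := by
    apply inv_le_one_of_one_le₀
    exact one_le_pow₀ (by
      have : (1 : ℝ) ≤ L := by exact_mod_cast hL1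
      exact one_le_pow₀ this)
  have hShM : (M ^ d)⁻¹ * Sh ≤ Hc := by
    calc (M ^ d)⁻¹ * Sh ≤ 1 * Sh := mul_le_mul_of_nonneg_right hMd1 hSh0
      _ = Sh := one_mul _
      _ ≤ Hc := hSh
  -- monotone replacement
  have p1 : (2 : ℝ) ^ (d + 1) * (M ^ 2)⁻¹ * (M ^ d * D) ≤ (2 : ℝ) ^ (d + 1) * (M ^ 2)⁻¹ * Dc :=
    mul_le_mul_of_nonneg_left hD (by positivity)
  have p2 : (d : ℝ) * (2 : ℝ) ^ d * K1 * (M ^ d * Sb) ≤ (d : ℝ) * (2 : ℝ) ^ d * K1 * Zc :=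
    mul_le_mul_of_nonneg_left hSb (by positivity)
  have p3 : (2 : ℝ) ^ (3 * d + 2) * d * (M ^ d * D) ≤ (2 : ℝ) ^ (3 * d + 2) * d * Dc :=
    mul_le_mul_of_nonneg_left hD (by positivity)
  have p4 : (2 : ℝ) ^ d * K2 * (M ^ d * Sb) ≤ (2 : ℝ) ^ d * K2 * Zc := mul_le_mul_of_nonneg_left hSb (by positivity)
  have p5 : 2 * (64 : ℝ) ^ d * ((M ^ d)⁻¹ * Sh) ≤ 2 * (64 : ℝ) ^ d * Hc := mul_le_mul_of_nonneg_left hShM (by positivity)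
  have p34' : 2 * (64 : ℝ) ^ d * ((2 : ℝ) ^ (3 * d + 2) * d * (M ^ d * D) + (2 : ℝ) ^ d * K2 * (M ^ d * Sb))
      ≤ 2 * (64 : ℝ) ^ d * ((2 : ℝ) ^ (3 * d + 2) * d * Dc + (2 : ℝ) ^ d * K2 * Zc) :=
    mul_le_mul_of_nonneg_left (add_le_add p3 p4) (by positivity)
  have p34 : 3 * ((d : ℝ) * κ2) * (2 * (64 : ℝ) ^ d * ((2 : ℝ) ^ (3 * d + 2) * d * (M ^ d * D) + (2 : ℝ) ^ d * K2 * (M ^ d * Sb))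
        + 2 * (64 : ℝ) ^ d * ((M ^ d)⁻¹ * Sh))
      ≤ 3 * ((d : ℝ) * κ2) * (2 * (64 : ℝ) ^ d * ((2 : ℝ) ^ (3 * d + 2) * d * Dc + (2 : ℝ) ^ d * K2 * Zc) + 2 * (64 : ℝ) ^ d * Hc) :=
    mul_le_mul_of_nonneg_left (add_le_add p34' p5) (by positivity)
  have p6 : 12 * (d : ℝ) * Sh ≤ 12 * (d : ℝ) * Hc := mul_le_mul_of_nonneg_left hSh (by positivity)
  have q1 : 3 * ((2 : ℝ) ^ (d + 1) * (M ^ 2)⁻¹ * (M ^ d * D) + (d : ℝ) * (2 : ℝ) ^ d * K1 * (M ^ d * Sb))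
      ≤ 3 * ((2 : ℝ) ^ (d + 1) * (M ^ 2)⁻¹ * Dc + (d : ℝ) * (2 : ℝ) ^ d * K1 * Zc) :=
    mul_le_mul_of_nonneg_left (add_le_add p1 p2) (by norm_num)
  rw [hid1, hid2, hid3] at h5
  exact h5.trans (add_le_add (add_le_add q1 p6) p34)

/-! ## §3 The nested-fix data are J2-small -/

/-- **THE UNFIXED COMPETITOR IS ℓ²-CLOSE TO `ζ′`** (K6-Ξ's displayed smallness): with `F₀ := competitorW M W ψ c`,
`Σ nhsNormSq (F₀ − ζ′) ≤ 8M²·Σ‖gaugeDir W F₀‖² + 8M²·G_ζ + 4·card n·C_J²·Z` (`sum_nhsNormSq_le_two_blocks`; the single-scale mean of `F₀ − ζ′` is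
`(bmeanIterW − bmeanW) ζ′` by `bmeanW_competitorW`, J2 in nhs currency). [folklore] -/
theorem sum_nhsNormSq_F0_sub_le [Nonempty n] {L : ℕ} (hL : 2 ≤ L) (N k : ℕ) {W : Site d → Fin d → (Matrix n n ℂ)ˣ} {x : ℝ}
    (hWu : IsUnitaryCfg W) (hx : 0 ≤ x) (hs : LevelSmall d L k x) (hWx : SmallField W x)
    (hsmall : 8 * d * (((L : ℝ) ^ (k + 1)) * (((d : ℝ) - 1) * (((L : ℝ) ^ (k + 1)) - 1) * x)) ^ 2
      + 2 * (Fintype.card n * (4 * (d : ℝ) ^ 2 * ((L : ℝ) ^ (k + 1) - 1) ^ 2 * x + 16 * d * loopRad d L ((prop1Radius d L)^[k] x)) ^ 2)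
        ≤ 1 / 2)
    (ζ' : Site d → Matrix n n ℂ) :
    ∑ y ∈ periodBox (d := d) (L ^ (k + 1) * N), nhsNormSq ((competitorW (L ^ (k + 1)) W (bmeanIterW L (k + 1) W ζ') (fun z => ζ' ((((L ^ (k + 1) : ℕ) : ℤ)) • z))) y - ζ' y)
      ≤ 8 * ((L : ℝ) ^ (k + 1)) ^ 2 * ∑ y ∈ periodBox (d := d) (L ^ (k + 1) * N), ∑ α : Fin d, ‖gaugeDir W (competitorW (L ^ (k + 1)) W (bmeanIterW L (k + 1) W ζ') (fun z => ζ' ((((L ^ (k + 1) : ℕ) : ℤ)) • z))) y α‖ ^ 2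
        + 8 * ((L : ℝ) ^ (k + 1)) ^ 2 * ∑ y ∈ periodBox (d := d) (L ^ (k + 1) * N), ∑ μ : Fin d, nhsNormSq (gaugeDir W ζ' y μ)
        + 4 * ((Fintype.card n : ℝ) * (4 * (d : ℝ) ^ 2 * (((L : ℝ) ^ (k + 1)) - 1) ^ 2 * x + 16 * d * loopRad d L ((prop1Radius d L)^[k] x)) ^ 2 * ∑ y ∈ periodBox (d := d) (L ^ (k + 1) * N), nhsNormSq (ζ' y)) := by
  have hM1 : 1 ≤ L ^ (k + 1) := Nat.one_le_pow _ _ (by omega)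
  have hM2 : 2 ≤ L ^ (k + 1) := le_trans hL (Nat.le_self_pow (Nat.succ_ne_zero k) L)
  have hMR : (((L ^ (k + 1) : ℕ) : ℝ)) = (L : ℝ) ^ (k + 1) := by push_cast; ring
  set F₀ := (competitorW (L ^ (k + 1)) W (bmeanIterW L (k + 1) W ζ') (fun z => ζ' ((((L ^ (k + 1) : ℕ) : ℤ)) • z))) with hF₀
  -- the two-block split
  have h2 := sum_nhsNormSq_le_two_blocks hM1 N hWu hx hWx (fun y => F₀ y - ζ' y)
  rw [hMR] at h2
  -- the single-scale mean of `F₀ − ζ′`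
  have hmean : ∀ z : Site d, bmeanW (L ^ (k + 1)) W (fun y => F₀ y - ζ' y) z
      = bmeanIterW L (k + 1) W ζ' z - bmeanW (L ^ (k + 1)) W ζ' z := by
    intro z
    rw [bmeanW_sub', hF₀, bmeanW_competitorW hM2]
  have hJ := sum_nhsNormSq_bmeanIterW_sub_bmeanW_le hL k hWu hx hs hWx ζ' N
  have hmass : ∑ z ∈ periodBox (d := d) N, ((L : ℝ) ^ (k + 1)) ^ d * nhsNormSq (bmeanW (L ^ (k + 1)) W (fun y => F₀ y - ζ' y) z)
      ≤ Fintype.card n * (4 * (d : ℝ) ^ 2 * (((L : ℝ) ^ (k + 1)) - 1) ^ 2 * x + 16 * d * loopRad d L ((prop1Radius d L)^[k] x)) ^ 2 * ∑ y ∈ periodBox (d := d) (L ^ (k + 1) * N), nhsNormSq (ζ' y) := by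
    calc ∑ z ∈ periodBox (d := d) N, ((L : ℝ) ^ (k + 1)) ^ d * nhsNormSq (bmeanW (L ^ (k + 1)) W (fun y => F₀ y - ζ' y) z)
        = ∑ z ∈ periodBox (d := d) N, ((L : ℝ) ^ (k + 1)) ^ d
            * nhsNormSq (bmeanIterW L (k + 1) W ζ' z - bmeanW (L ^ (k + 1)) W ζ' z) := by
          refine sum_congr rfl fun z _ => ?_
          rw [hmean z]
      _ ≤ _ := hJ
  -- the gauge energy of `F₀ − ζ′`
  have hG : ∑ y ∈ periodBox (d := d) (L ^ (k + 1) * N), ∑ μ : Fin d, nhsNormSq (gaugeDir W (fun y => F₀ y - ζ' y) y μ)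
      ≤ 2 * ∑ y ∈ periodBox (d := d) (L ^ (k + 1) * N), ∑ α : Fin d, ‖gaugeDir W F₀ y α‖ ^ 2 + 2 * ∑ y ∈ periodBox (d := d) (L ^ (k + 1) * N), ∑ μ : Fin d, nhsNormSq (gaugeDir W ζ' y μ) := by
    have hpt : ∀ (y : Site d) (μ : Fin d), nhsNormSq (gaugeDir W (fun y => F₀ y - ζ' y) y μ)
        ≤ 2 * ‖gaugeDir W F₀ y μ‖ ^ 2 + 2 * nhsNormSq (gaugeDir W ζ' y μ) := by
      intro y μ
      rw [gaugeDir_sub_fun']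
      have h := nhsNormSq_sub_le (gaugeDir W F₀ y μ) (gaugeDir W ζ' y μ)
      have h' := nhsNormSq_le_opNorm_sq (gaugeDir W F₀ y μ)
      linarith
    calc ∑ y ∈ periodBox (d := d) (L ^ (k + 1) * N), ∑ μ : Fin d, nhsNormSq (gaugeDir W (fun y => F₀ y - ζ' y) y μ)
        ≤ ∑ y ∈ periodBox (d := d) (L ^ (k + 1) * N), ∑ μ : Fin d, (2 * ‖gaugeDir W F₀ y μ‖ ^ 2 + 2 * nhsNormSq (gaugeDir W ζ' y μ)) :=
          sum_le_sum fun y _ => sum_le_sum fun μ _ => hpt y μ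
      _ = _ := by simp only [sum_add_distrib, mul_sum]
  -- the displayed smallness absorbs the K2 constant
  have hs1 : 2 * (4 * d * (((L : ℝ) ^ (k + 1)) * (((d : ℝ) - 1) * (((L : ℝ) ^ (k + 1)) - 1) * x)) ^ 2) ≤ 1 / 2 := by
    nlinarith [hsmall, sq_nonneg (Fintype.card n * (4 * (d : ℝ) ^ 2 * (((L : ℝ) ^ (k + 1)) - 1) ^ 2 * x + 16 * d * loopRad d L ((prop1Radius d L)^[k] x)))]
  have hΞ0 : 0 ≤ ∑ y ∈ periodBox (d := d) (L ^ (k + 1) * N), nhsNormSq (F₀ y - ζ' y) := sum_nonneg fun y _ => nhsNormSq_nonneg _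
  have hM20 : 0 ≤ ((L : ℝ) ^ (k + 1)) ^ 2 := by positivity
  nlinarith [h2, hmass, mul_le_mul_of_nonneg_left hG hM20, mul_le_mul_of_nonneg_right hs1 hΞ0]

/-- **THE NESTED-FIX DATA `T = Σ_z ‖ψ z − bmeanIterW L (k+1) W F₀ z‖²` ARE J2-SMALL**:
`M^d·T ≤ 2·C_J²·(card n·Σ nhsNormSq (F₀ − ζ′)) + 2·C_J²·(card n·Z)` (`bmeanIterW (F₀ − ζ′) = (bmeanIterW − bmeanW)(F₀ − ζ′) + (bmeanIterW − bmeanW) ζ′`,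
J2 `sum_norm_bmeanIterW_sub_bmeanW_sq_le` twice, op ≤ `card n`·nhs). [folklore] -/
theorem pow_mul_sum_normSq_target_sub_le [Nonempty n] {L : ℕ} (hL : 2 ≤ L) (N k : ℕ) {W : Site d → Fin d → (Matrix n n ℂ)ˣ} {x : ℝ}
    (hWu : IsUnitaryCfg W) (hx : 0 ≤ x) (hs : LevelSmall d L k x) (hWx : SmallField W x) (ζ' : Site d → Matrix n n ℂ) :
    ((L : ℝ) ^ (k + 1)) ^ d * ∑ z ∈ periodBox (d := d) N,
        ‖bmeanIterW L (k + 1) W ζ' z - bmeanIterW L (k + 1) W (competitorW (L ^ (k + 1)) W (bmeanIterW L (k + 1) W ζ') (fun z => ζ' ((((L ^ (k + 1) : ℕ) : ℤ)) • z))) z‖ ^ 2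
      ≤ 2 * (4 * (d : ℝ) ^ 2 * (((L : ℝ) ^ (k + 1)) - 1) ^ 2 * x + 16 * d * loopRad d L ((prop1Radius d L)^[k] x)) ^ 2 * ((Fintype.card n : ℝ) * ∑ y ∈ periodBox (d := d) (L ^ (k + 1) * N), nhsNormSq ((competitorW (L ^ (k + 1)) W (bmeanIterW L (k + 1) W ζ') (fun z => ζ' ((((L ^ (k + 1) : ℕ) : ℤ)) • z))) y - ζ' y))
        + 2 * (4 * (d : ℝ) ^ 2 * (((L : ℝ) ^ (k + 1)) - 1) ^ 2 * x + 16 * d * loopRad d L ((prop1Radius d L)^[k] x)) ^ 2 * ((Fintype.card n : ℝ) * ∑ y ∈ periodBox (d := d) (L ^ (k + 1) * N), nhsNormSq (ζ' y)) := by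
  have hM2 : 2 ≤ L ^ (k + 1) := le_trans hL (Nat.le_self_pow (Nat.succ_ne_zero k) L)
  set F₀ := (competitorW (L ^ (k + 1)) W (bmeanIterW L (k + 1) W ζ') (fun z => ζ' ((((L ^ (k + 1) : ℕ) : ℤ)) • z))) with hF₀
  have hMd : 0 ≤ ((L : ℝ) ^ (k + 1)) ^ d := by positivity
  -- the pointwise identity
  have hpt : ∀ z : Site d, bmeanIterW L (k + 1) W ζ' z - bmeanIterW L (k + 1) W F₀ z
      = -((bmeanIterW L (k + 1) W (fun y => F₀ y - ζ' y) z - bmeanW (L ^ (k + 1)) W (fun y => F₀ y - ζ' y) z)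
          + (bmeanIterW L (k + 1) W ζ' z - bmeanW (L ^ (k + 1)) W ζ' z)) := by
    intro z
    rw [bmeanIterW_sub', bmeanW_sub', hF₀, bmeanW_competitorW hM2]
    abel
  have hJ1 := sum_norm_bmeanIterW_sub_bmeanW_sq_le hL k hWu hx hs hWx (fun y => F₀ y - ζ' y) N
  have hJ2 := sum_norm_bmeanIterW_sub_bmeanW_sq_le hL k hWu hx hs hWx ζ' N
  have hc1 := sum_norm_sq_le_card_mul (periodBox (d := d) (L ^ (k + 1) * N)) (fun y => F₀ y - ζ' y)
  have hc2 := sum_norm_sq_le_card_mul (periodBox (d := d) (L ^ (k + 1) * N)) ζ'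
  have hC0 : 0 ≤ (4 * (d : ℝ) ^ 2 * (((L : ℝ) ^ (k + 1)) - 1) ^ 2 * x + 16 * d * loopRad d L ((prop1Radius d L)^[k] x)) ^ 2 := by positivity
  calc ((L : ℝ) ^ (k + 1)) ^ d * ∑ z ∈ periodBox (d := d) N, ‖bmeanIterW L (k + 1) W ζ' z - bmeanIterW L (k + 1) W F₀ z‖ ^ 2
      ≤ ((L : ℝ) ^ (k + 1)) ^ d * ∑ z ∈ periodBox (d := d) N,
          (2 * ‖bmeanIterW L (k + 1) W (fun y => F₀ y - ζ' y) z - bmeanW (L ^ (k + 1)) W (fun y => F₀ y - ζ' y) z‖ ^ 2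
            + 2 * ‖bmeanIterW L (k + 1) W ζ' z - bmeanW (L ^ (k + 1)) W ζ' z‖ ^ 2) := by
        gcongr with z hz
        rw [hpt z, norm_neg]
        exact norm_add_sq_le' _ _
    _ = 2 * ∑ z ∈ periodBox (d := d) N, ((L : ℝ) ^ (k + 1)) ^ d
            * ‖bmeanIterW L (k + 1) W (fun y => F₀ y - ζ' y) z - bmeanW (L ^ (k + 1)) W (fun y => F₀ y - ζ' y) z‖ ^ 2
          + 2 * ∑ z ∈ periodBox (d := d) N, ((L : ℝ) ^ (k + 1)) ^ d * ‖bmeanIterW L (k + 1) W ζ' z - bmeanW (L ^ (k + 1)) W ζ' z‖ ^ 2 := by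
        rw [mul_sum, mul_sum, mul_sum, ← sum_add_distrib]
        exact sum_congr rfl fun z _ => by ring
    _ ≤ 2 * ((4 * (d : ℝ) ^ 2 * (((L : ℝ) ^ (k + 1)) - 1) ^ 2 * x + 16 * d * loopRad d L ((prop1Radius d L)^[k] x)) ^ 2 * ∑ y ∈ periodBox (d := d) (L ^ (k + 1) * N), ‖F₀ y - ζ' y‖ ^ 2)
          + 2 * ((4 * (d : ℝ) ^ 2 * (((L : ℝ) ^ (k + 1)) - 1) ^ 2 * x + 16 * d * loopRad d L ((prop1Radius d L)^[k] x)) ^ 2 * ∑ y ∈ periodBox (d := d) (L ^ (k + 1) * N), ‖ζ' y‖ ^ 2) := by gcongr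
    _ ≤ _ := by nlinarith [mul_le_mul_of_nonneg_left hc1 hC0, mul_le_mul_of_nonneg_left hc2 hC0]

end

end Summit.QuantumFields.BalabanUV.T4Continuum.NE3SlicePoincareCompetitorEnergy
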